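import Mathlib.Algebra.Polynomial.Degree.Support
import Mathlib.Algebra.Polynomial.Coeff
import Mathlib.Algebra.Polynomial.Eval.Coeff
import Mathlib.RingTheory.Ideal.Maps
import Mathlib.RingTheory.Ideal.Colon
import Mathlib.RingTheory.Polynomial.Basic
import HarnessLib

/-!
# Crux `PatchingRelPerfect` (stmt-ResolutionOfSingularities-16161), chain W5.2 — the depth-`ℓ` programme beyond the
# graded case, RING-LEVEL CORE: Taylor coefficient ideals of an ideal of `B[t]`, permissibility transfer, and the
# generator-wise transform law under `t ↦ z·t′` (lead prover, gen 3; DESIGN NOTE «nongraded-filtered» §1 (a)(b))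

[OURS · L1 W5.2 · lead] Replaces the role of NO printed item; NOT a statement of the manuscript under review.

On a trivialising affine `W₀ = Spec B` of the line bundle `r : U → E` (the retraction of the chain's X-side, an
`𝔸¹`-bundle), the residual ideal of a depth-`ℓ` member is an ideal `𝔎 ⊆ B[t]` with `t^ℓ ∈ 𝔎`; its E-side datum is the
family of COEFFICIENT IDEALS `coeffIdeal 𝔎 b = {coeff_b p : p ∈ 𝔎} ⊆ B` (Kawanoue–Matsuki's idealistic filtration,
level `ℓ − b`), and one dictionary step (blow up `V(𝔷B[t] + tB[t])`, `z`-chart) is the ring map `t ↦ z t′` over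
`B → B′ = B[𝔷/z]` followed by division by `z^ℓ`. This file proves the pure polynomial algebra:

* `coeffIdeal`, `coeffIdeal_mono` (`X · 𝔎 ⊆ 𝔎` shifts coefficients up: the flag is increasing);
* **`le_pow_of_coeff_mem_pow` — PERMISSIBILITY TRANSFER**: if `coeff_b p ∈ C^{ℓ−b}` for all `p ∈ 𝔎`, `b < ℓ`, then
  `𝔎 ≤ (C·B[t] + (t))^ℓ`;
* **`exists_eq_C_pow_mul_of_coeff` — the GENERATOR-WISE TRANSFORM LAW**: for a map `φ : B[t] → B′[t′]` with
  `coeff_b (φ p) = z^b · f(coeff_b p)` (the `z`-chart substitution `t ↦ z t′` over `f : B → B′`) and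
  `f(coeff_b p) = z^{ℓ−b} · c′_b` for `b < ℓ` (E-side permissibility, divided out), `φ p = z^ℓ · q` with
  `coeff_b q = c′_b` for `b < ℓ` — the Taylor coefficients of the controlled transform are the weight-`(ℓ−b)` controlled
  transforms of the Taylor coefficients (K–M's transformation rule, generator by generator);
* `colon_map_eq_span_of_forall` — for `φ` a ring map and `z` a non-zero-divisor, `(𝔎·B′[t′] : z^ℓ)` is spanned by the
  quotients `q_p`, `p ∈ 𝔎`.

Fact-free; AI-written, weaker than expert review. The scheme glue (`𝔸¹`-bundle charts of the blow-up) is a separate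
object.

## References
* H. Kawanoue, K. Matsuki, Adv. Stud. Pure Math. 70 (2016), §2 (idealistic filtrations; Problem 4 and its
  transformation rule). [KawanoueMatsuki2016]
* E. Bierstone, D. Grigoriev, P. Milman, J. Włodarczyk, arXiv:1206.3090, §3.2 Lemma 3.2.1. [BierstoneGrigorievMilmanWlodarczyk2011]
-/

-- `Summit.<Summit>.<Sub>.Theorems` with `Sub = Summit` (single-conjunct summit, D-0017)
set_option linter.dupNamespace false

noncomputable section

open Polynomial

namespace Summit.ResolutionOfSingularities.ResolutionOfSingularities.Theorems

universe u

namespace DepthGraded.Taylor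

variable {B : Type u} [CommRing B]

/-! ## §1 Coefficient ideals -/

/-- [OURS · L1 W5.2 · lead] **The `b`-th coefficient ideal** of an ideal `𝔎 ⊆ B[t]`: `{coeff_b p : p ∈ 𝔎}` (an ideal of
`B`: the image of `𝔎` under the `B`-linear map `coeff_b`). Level `ℓ − b` of the coefficient filtration.
[cite: KawanoueMatsuki2016, §2] -/
def coeffIdeal (𝔎 : Ideal B[X]) (b : ℕ) : Ideal B :=
  Submodule.map (Polynomial.lcoeff B b) (𝔎.restrictScalars B)

/-- Membership in the coefficient ideal. [folklore] -/
theorem mem_coeffIdeal_iff {𝔎 : Ideal B[X]} {b : ℕ} {c : B} :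
    c ∈ coeffIdeal 𝔎 b ↔ ∃ p ∈ 𝔎, p.coeff b = c := by
  simp only [coeffIdeal, Submodule.mem_map, Submodule.restrictScalars_mem, Polynomial.lcoeff_apply]

/-- Coefficients of members lie in the coefficient ideals. [folklore] -/
theorem coeff_mem_coeffIdeal {𝔎 : Ideal B[X]} {p : B[X]} (hp : p ∈ 𝔎) (b : ℕ) : p.coeff b ∈ coeffIdeal 𝔎 b :=
  mem_coeffIdeal_iff.mpr ⟨p, hp, rfl⟩

/-- **The coefficient flag is increasing**: `coeffIdeal 𝔎 b ≤ coeffIdeal 𝔎 (b + 1)` (`coeff_{b+1}(t·p) = coeff_b p`).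
[cite: KawanoueMatsuki2016, §2] -/
theorem coeffIdeal_mono (𝔎 : Ideal B[X]) (b : ℕ) : coeffIdeal 𝔎 b ≤ coeffIdeal 𝔎 (b + 1) := by
  intro c hc
  obtain ⟨p, hp, rfl⟩ := mem_coeffIdeal_iff.mp hc
  exact mem_coeffIdeal_iff.mpr ⟨X * p, 𝔎.mul_mem_left X hp, by rw [Polynomial.coeff_X_mul]⟩

/-- Monotonicity in the ideal. [folklore] -/
theorem coeffIdeal_mono_left {𝔎 𝔎' : Ideal B[X]} (h : 𝔎 ≤ 𝔎') (b : ℕ) : coeffIdeal 𝔎 b ≤ coeffIdeal 𝔎' b := by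
  intro c hc
  obtain ⟨p, hp, rfl⟩ := mem_coeffIdeal_iff.mp hc
  exact mem_coeffIdeal_iff.mpr ⟨p, h hp, rfl⟩

/-! ## §2 Permissibility transfer -/

/-- [OURS · L1 W5.2 · lead] **PERMISSIBILITY TRANSFER (polynomial form).** Let `C ⊆ B` be an ideal (the centre on the
base) and `Ĉ = C·B[t] + (t)` (the centre `V(C) × {0}` in `Spec B[t]`). If every coefficient `coeff_b p`, `b < ℓ`,
of every `p ∈ 𝔎` lies in `C^{ℓ−b}` — i.e. `coeffIdeal 𝔎 b ≤ C^{ℓ−b}`, «`V(C)` lies in the singular locus of the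
coefficient filtration» — then `𝔎 ≤ Ĉ^ℓ` (`p = Σ_b coeff_b · t^b` with `C^{ℓ−b}·t^b ⊆ Ĉ^ℓ` for `b < ℓ` and
`t^b ∈ Ĉ^ℓ` for `b ≥ ℓ`). [cite: KawanoueMatsuki2016, §2 Problem 4] [cite: BierstoneGrigorievMilmanWlodarczyk2011, §3.2 Lemma 3.2.1] -/
theorem le_pow_of_coeff_mem_pow {𝔎 : Ideal B[X]} {C : Ideal B} {ℓ : ℕ}
    (h : ∀ p ∈ 𝔎, ∀ b < ℓ, p.coeff b ∈ C ^ (ℓ - b)) :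
    𝔎 ≤ (C.map (Polynomial.C : B →+* B[X]) ⊔ Ideal.span {(X : B[X])}) ^ ℓ := by
  intro p hp
  set Ch : Ideal B[X] := C.map (Polynomial.C : B →+* B[X]) ⊔ Ideal.span {(X : B[X])} with hCh
  rw [Polynomial.as_sum_range_C_mul_X_pow p]
  refine Submodule.sum_mem _ fun b _ => ?_
  have hX : (X : B[X]) ∈ Ch := Ideal.mem_sup_right (Ideal.mem_span_singleton_self _)
  by_cases hb : b < ℓ
  · -- `C(coeff_b p) ∈ Ĉ^{ℓ−b}` and `t^b ∈ Ĉ^b`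
    have h1 : Polynomial.C (p.coeff b) ∈ Ch ^ (ℓ - b) := by
      have : Polynomial.C (p.coeff b) ∈ (C ^ (ℓ - b)).map (Polynomial.C : B →+* B[X]) :=
        Ideal.mem_map_of_mem _ (h p hp b hb)
      rw [Ideal.map_pow] at this
      exact Ideal.pow_right_mono (le_sup_left) _ this
    have h2 : (X : B[X]) ^ b ∈ Ch ^ b := Ideal.pow_mem_pow hX b
    have h3 := Ideal.mul_mem_mul h1 h2
    rw [← pow_add, Nat.sub_add_cancel hb.le] at h3
    exact h3
  · -- `t^b ∈ Ĉ^ℓ` for `b ≥ ℓ`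
    push Not at hb
    have h2 : (X : B[X]) ^ b ∈ Ch ^ ℓ := Ideal.pow_le_pow_right hb (Ideal.pow_mem_pow hX b)
    exact Ideal.mul_mem_left _ _ h2

/-! ## §3 The generator-wise transform law under `t ↦ z·t′` -/

section Transform

variable {B' : Type u} [CommRing B'] (f : B →+* B') (z : B')

/-- [OURS · L1 W5.2 · lead] **The generator-wise TRANSFORM LAW.** `φ : B[t] → B′[t′]` any map with
`coeff_b (φ p) = z^b · f(coeff_b p)` (the `z`-chart substitution `t ↦ z t′` over `f : B → B′`). If the Taylor
coefficients of `p` of order `b < ℓ` are divisible on the base in the weighted way — `f(coeff_b p) = z^{ℓ−b} · c′_b`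
(E-side permissibility: `coeff_b p ∈ 𝔷^{ℓ−b}`, divided by `z^{ℓ−b}` on the chart of `Bl_𝔷 B`) — then
`φ p = z^ℓ · q` with `coeff_b q = c′_b` for `b < ℓ`: the Taylor coefficients of the weight-`ℓ` controlled transform are
the weight-`(ℓ−b)` controlled transforms of the Taylor coefficients. [cite: KawanoueMatsuki2016, §2 (transformation of an idealistic filtration)]
[cite: BierstoneGrigorievMilmanWlodarczyk2011, §3.2 Lemma 3.2.1] -/
theorem exists_eq_C_pow_mul_of_coeff (φ : B[X] → B'[X]) (hφ : ∀ (p : B[X]) (b : ℕ), (φ p).coeff b = z ^ b * f (p.coeff b))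
    {ℓ : ℕ} (p : B[X]) (c' : ℕ → B') (hc' : ∀ b < ℓ, f (p.coeff b) = z ^ (ℓ - b) * c' b) :
    ∃ q : B'[X], φ p = Polynomial.C (z ^ ℓ) * q ∧ ∀ b < ℓ, q.coeff b = c' b := by
  classical
  -- the coefficient function of `q`
  let g : ℕ → B' := fun n => if n < ℓ then c' n else z ^ (n - ℓ) * f (p.coeff n)
  let N : ℕ := max ℓ ((φ p).natDegree + 1)
  let q : B'[X] := ∑ n ∈ Finset.range N, Polynomial.C (g n) * X ^ n
  have hq : ∀ m, q.coeff m = if m < N then g m else 0 := by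
    intro m
    simp only [q, Polynomial.finsetSum_coeff, Polynomial.coeff_C_mul_X_pow]
    rw [Finset.sum_ite_eq (Finset.range N) m g]
    simp only [Finset.mem_range]
  refine ⟨q, ?_, fun b hb => ?_⟩
  · ext m
    rw [Polynomial.coeff_C_mul, hq m, hφ p m]
    by_cases hm : m < N
    · rw [if_pos hm]
      by_cases hml : m < ℓ
      · simp only [g, if_pos hml]
        rw [hc' m hml, ← mul_assoc, ← pow_add, Nat.add_sub_cancel' hml.le]
      · simp only [g, if_neg hml]
        push Not at hml
        rw [← mul_assoc, ← pow_add, Nat.add_sub_cancel' hml]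
    · rw [if_neg hm, mul_zero]
      -- `m ≥ N > natDegree (φ p)`, so the coefficient vanishes
      push Not at hm
      have hdeg : (φ p).natDegree < m := by
        have : (φ p).natDegree + 1 ≤ N := le_max_right _ _
        omega
      rw [← hφ p m]
      exact Polynomial.coeff_eq_zero_of_natDegree_lt hdeg
  · rw [hq b]
    have hbN : b < N := lt_of_lt_of_le hb (le_max_left _ _)
    rw [if_pos hbN]
    simp only [g, if_pos hb]

/-- [OURS · L1 W5.2 · lead] **The controlled transform is spanned by the quotients**: for a ring map
`φ : B[t] → B′[t′]` and `z` whose power `z^ℓ` is a non-zero-divisor of `B′[t′]` (as a constant), if every `p ∈ 𝔎`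
satisfies `φ p = z^ℓ · q_p`, then `(𝔎·B′[t′] : z^ℓ) = span {q_p}`. [cite: BierstoneGrigorievMilmanWlodarczyk2011, §3.2 Lemma 3.2.1] -/
theorem colon_map_eq_span_of_forall (φ : B[X] →+* B'[X]) {ℓ : ℕ} (𝔎 : Ideal B[X]) (q : B[X] → B'[X])
    (hq : ∀ p ∈ 𝔎, φ p = Polynomial.C (z ^ ℓ) * q p)
    (hz : ∀ x : B'[X], Polynomial.C (z ^ ℓ) * x = 0 → x = 0) :
    (𝔎.map φ).colon (Ideal.span {Polynomial.C (z ^ ℓ)}) = Ideal.span (q '' (𝔎 : Set B[X])) := by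
  apply le_antisymm
  · intro x hx
    rw [Ideal.mem_colon_span_singleton] at hx
    -- every element of `𝔎.map φ` is `z^ℓ` times an element of the span
    have key : ∀ y ∈ 𝔎.map φ, ∃ w ∈ Ideal.span (q '' (𝔎 : Set B[X])), y = Polynomial.C (z ^ ℓ) * w := by
      intro y hy
      refine Submodule.span_induction (p := fun y _ => ∃ w ∈ Ideal.span (q '' (𝔎 : Set B[X])),
        y = Polynomial.C (z ^ ℓ) * w) ?_ ?_ ?_ ?_ hy
      · rintro _ ⟨p, hp, rfl⟩
        exact ⟨q p, Ideal.subset_span ⟨p, hp, rfl⟩, hq p hp⟩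
      · exact ⟨0, Submodule.zero_mem _, by rw [mul_zero]⟩
      · rintro y₁ y₂ - - ⟨w₁, hw₁, rfl⟩ ⟨w₂, hw₂, rfl⟩
        exact ⟨w₁ + w₂, Submodule.add_mem _ hw₁ hw₂, by rw [mul_add]⟩
      · rintro a y - ⟨w, hw, rfl⟩
        exact ⟨a * w, Ideal.mul_mem_left _ a hw, by rw [smul_eq_mul, mul_left_comm]⟩
    obtain ⟨w, hw, hyw⟩ := key _ hx
    have : x = w := by
      have h0 : Polynomial.C (z ^ ℓ) * (x - w) = 0 := by rw [mul_sub, mul_comm, hyw, sub_self]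
      exact sub_eq_zero.mp (hz _ h0)
    rw [this]
    exact hw
  · rw [Ideal.span_le]
    rintro _ ⟨p, hp, rfl⟩
    rw [SetLike.mem_coe, Ideal.mem_colon_span_singleton, mul_comm, ← hq p hp]
    exact Ideal.mem_map_of_mem φ hp

/-- **Coefficient ideals of a span**: the `b`-th coefficient ideal of `span Q` is generated by the coefficients of
orders `j ≤ b` of the members of `Q` (`coeff_b (g·q) = Σ_{i+j=b} g_i q_j`, and `coeff_j q = coeff_b (t^{b−j} q)`).
[folklore] -/
theorem coeffIdeal_span_eq (Q : Set B'[X]) (b : ℕ) :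
    coeffIdeal (Ideal.span Q) b = ⨆ j ∈ Finset.range (b + 1), Ideal.span {c | ∃ q ∈ Q, q.coeff j = c} := by
  apply le_antisymm
  · intro c hc
    obtain ⟨y, hy, rfl⟩ := mem_coeffIdeal_iff.mp hc
    -- by induction over the span, for all orders at once
    suffices H : ∀ b, y.coeff b ∈ ⨆ j ∈ Finset.range (b + 1), Ideal.span {c | ∃ q ∈ Q, q.coeff j = c} from H b
    refine Submodule.span_induction (p := fun y _ => ∀ b, y.coeff b ∈
        ⨆ j ∈ Finset.range (b + 1), Ideal.span {c | ∃ q ∈ Q, q.coeff j = c}) ?_ ?_ ?_ ?_ hy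
    · intro q hq b
      exact Ideal.mem_iSup_of_mem b (Ideal.mem_iSup_of_mem (Finset.self_mem_range_succ b)
        (Ideal.subset_span ⟨q, hq, rfl⟩))
    · intro b
      rw [Polynomial.coeff_zero]
      exact Submodule.zero_mem _
    · intro y₁ y₂ _ _ h₁ h₂ b
      rw [Polynomial.coeff_add]
      exact Submodule.add_mem _ (h₁ b) (h₂ b)
    · intro g y _ hy b
      rw [smul_eq_mul, Polynomial.coeff_mul]
      refine Submodule.sum_mem _ fun ij hij => ?_
      have hj : ij.2 ≤ b := by
        have := Finset.mem_antidiagonal.mp hij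
        omega
      refine Ideal.mul_mem_left _ _ ?_
      have hmono : (⨆ j ∈ Finset.range (ij.2 + 1), Ideal.span {c | ∃ q ∈ Q, q.coeff j = c}) ≤
          ⨆ j ∈ Finset.range (b + 1), Ideal.span {c | ∃ q ∈ Q, q.coeff j = c} :=
        biSup_mono fun x hx => Finset.mem_range.mpr (lt_of_lt_of_le (Finset.mem_range.mp hx) (Nat.succ_le_succ hj))
      exact hmono (hy ij.2)
  · refine iSup_le fun j => iSup_le fun hj => ?_
    rw [Finset.mem_range] at hj
    rw [Ideal.span_le]
    rintro _ ⟨q, hq, rfl⟩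
    have h : (X ^ (b - j) * q).coeff b = q.coeff j := by
      rw [Polynomial.coeff_X_pow_mul', if_pos (Nat.sub_le b j), Nat.sub_sub_self (Nat.lt_succ_iff.mp hj)]
    rw [SetLike.mem_coe, ← h]
    exact coeff_mem_coeffIdeal (Ideal.mul_mem_left _ _ (Ideal.subset_span hq)) b

/-- **Divided coefficient ideals as colons**: if on the base `f(coeff_j p) = z^{m} · c_j(p)` for all `p ∈ 𝔎` and `z^m`
is a non-zero-divisor of `B′`, then `span {c_j(p) : p ∈ 𝔎} = ((coeffIdeal 𝔎 j)·B′ : z^m)` — the weight-`m`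
controlled transform of the `j`-th coefficient ideal. [cite: BierstoneGrigorievMilmanWlodarczyk2011, §3.2 Lemma 3.2.1] -/
theorem span_dividedCoeff_eq_colon {𝔎 : Ideal B[X]} {j m : ℕ} (cj : B[X] → B')
    (hcj : ∀ p ∈ 𝔎, f (p.coeff j) = z ^ m * cj p) (hz : ∀ x : B', z ^ m * x = 0 → x = 0) :
    Ideal.span (cj '' (𝔎 : Set B[X])) = ((coeffIdeal 𝔎 j).map f).colon (Ideal.span {z ^ m}) := by
  apply le_antisymm
  · rw [Ideal.span_le]
    rintro _ ⟨p, hp, rfl⟩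
    rw [SetLike.mem_coe, Ideal.mem_colon_span_singleton, mul_comm, ← hcj p hp]
    exact Ideal.mem_map_of_mem f (coeff_mem_coeffIdeal hp j)
  · intro x hx
    rw [Ideal.mem_colon_span_singleton] at hx
    have key : ∀ y ∈ (coeffIdeal 𝔎 j).map f, ∃ w ∈ Ideal.span (cj '' (𝔎 : Set B[X])), y = z ^ m * w := by
      intro y hy
      refine Submodule.span_induction (p := fun y _ => ∃ w ∈ Ideal.span (cj '' (𝔎 : Set B[X])), y = z ^ m * w)
        ?_ ?_ ?_ ?_ hy
      · rintro _ ⟨c, hc, rfl⟩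
        obtain ⟨p, hp, rfl⟩ := mem_coeffIdeal_iff.mp hc
        exact ⟨cj p, Ideal.subset_span ⟨p, hp, rfl⟩, hcj p hp⟩
      · exact ⟨0, Submodule.zero_mem _, by rw [mul_zero]⟩
      · rintro y₁ y₂ - - ⟨w₁, hw₁, rfl⟩ ⟨w₂, hw₂, rfl⟩
        exact ⟨w₁ + w₂, Submodule.add_mem _ hw₁ hw₂, by rw [mul_add]⟩
      · rintro a y - ⟨w, hw, rfl⟩
        exact ⟨a * w, Ideal.mul_mem_left _ a hw, by rw [smul_eq_mul, mul_left_comm]⟩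
    obtain ⟨w, hw, hyw⟩ := key _ hx
    have : x = w := by
      have h0 : z ^ m * (x - w) = 0 := by rw [mul_sub, mul_comm, hyw, sub_self]
      exact sub_eq_zero.mp (hz _ h0)
    rw [this]
    exact hw

/-- [OURS · L1 W5.2 · lead] **The Kawanoue–Matsuki TRANSFORM LAW for the coefficient filtration (ring level).**
With `φ`, `f`, `z` as in `exists_eq_C_pow_mul_of_coeff`, quotients `q_p` with `φ p = z^ℓ q_p` and
`coeff_j q_p = c_j(p)` (`j < ℓ`), `f(coeff_j p) = z^{ℓ−j} c_j(p)` for `p ∈ 𝔎`, and the powers of `z` non-zero-divisors: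
for `b < ℓ`, the `b`-th coefficient ideal of the transform `𝔎′ = span {q_p}` is
`Σ_{j ≤ b} ((coeffIdeal 𝔎 j)·B′ : z^{ℓ−j})` — level by level the weighted controlled transforms, summed over the lower
orders (generator-wise transformation of an idealistic filtration of i.f.g. type). [cite: KawanoueMatsuki2016, §2 (transformation rule)] -/
theorem coeffIdeal_transform_eq {𝔎 : Ideal B[X]} {ℓ : ℕ} (q : B[X] → B'[X]) (c : B[X] → ℕ → B')
    (hqc : ∀ p ∈ 𝔎, ∀ j < ℓ, (q p).coeff j = c p j) (hc : ∀ p ∈ 𝔎, ∀ j < ℓ, f (p.coeff j) = z ^ (ℓ - j) * c p j)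
    (hz : ∀ (m : ℕ) (x : B'), z ^ m * x = 0 → x = 0) {b : ℕ} (hb : b < ℓ) :
    coeffIdeal (Ideal.span (q '' (𝔎 : Set B[X]))) b =
      ⨆ j ∈ Finset.range (b + 1), ((coeffIdeal 𝔎 j).map f).colon (Ideal.span {z ^ (ℓ - j)}) := by
  rw [coeffIdeal_span_eq]
  refine iSup_congr fun j => iSup_congr fun hj => ?_
  rw [Finset.mem_range] at hj
  have hjℓ : j < ℓ := lt_of_lt_of_le (Nat.lt_succ_iff.mp hj |>.trans_lt (Nat.lt_succ_self b)) hb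
  rw [← span_dividedCoeff_eq_colon f z (fun p => c p j) (fun p hp => hc p hp j hjℓ) (hz _)]
  congr 1
  ext x
  constructor
  · rintro ⟨_, ⟨p, hp, rfl⟩, rfl⟩
    exact ⟨p, hp, (hqc p hp j hjℓ).symm⟩
  · rintro ⟨p, hp, rfl⟩
    exact ⟨q p, ⟨p, hp, rfl⟩, hqc p hp j hjℓ⟩

end Transform

end DepthGraded.Taylor

end Summit.ResolutionOfSingularities.ResolutionOfSingularities.Theorems

end
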